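import Summits.ResolutionOfSingularities.ResolutionOfSingularities.Theorems.FrobeniusLadderFRationalResolutionClassOneThirdOneTwo
import Summits.ResolutionOfSingularities.ResolutionOfSingularities.Theorems.FrobeniusLadderFRationalResolutionVeroneseTwoChartSlots
import Summits.ResolutionOfSingularities.ResolutionOfSingularities.Theorems.FrobeniusLadderFRationalResolutionConeHomOfMatrix
import HarnessLib

/-!
# Crux `FrobeniusLadder.FRationalResolution` (stmt-ResolutionOfSingularities-15317), line `redirect`,
# stub `stub_diagonalizableQuotientResolution` — THE FIRST CLASS WITH A SINGULAR VERTEX CHART THROUGH THE PIPELINE: `1/4(1,3)` (`A₃`)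

The weight kernel `P = {m ∈ ℕ² : 4 ∣ m₀ + 3 m₁}` (`A₃`, wild in characteristic `2` as `𝔸²/μ₄`): Hilbert basis `G = {(4,0),(1,1),(0,4)}`,
all vertices; the vertex charts at `(4,0)` and `(0,4)` are free (`ℕ²`, integer matrices of determinant `4`), the chart at `(1,1)` is the
`A₁` cone, presented as the Veronese monoid `Q = ⟨{d : |d| = 2}⟩ ⊆ ℕ²` with the RATIONAL cone map `ι = L/2`, `L = (3 −1; −1 3)`
(`…ConeHomOfMatrix`, p844001), its faces and vertex certificate supplied by `…VeroneseTwoChartSlots.veroneseTwo_chartSlots` (p844019).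
So this class runs through BOTH disjuncts of `…ConeCertificateFreeChart.hasResolution_of_isolated_fixedPoints_of_mixedConeCertificate`:
the naive two-step recipe (blow up the point, then the one singular point `A₁` of the first blow-up).

* `freeChart_of_matrix` — a free vertex chart from a `2 × 2` matrix and generator checks (the `pack` step of `…ClassOneThirdOneTwo`, stated);
* `middleChart_oneFourth` — the cone data of the `A₁` chart at `(1,1)`;
* ★★★★ `hasResolution_of_isolated_fixedPoints_oneFourth`.

Honest label: a TOY instance (surface `A₃`) exercising every slot of the class pipeline, including the singular-vertex-chart disjunct;
no stub, crux or summit closed. No definitions, no named facts, no sorry. [folklore; cite: CoxLittleSchenck2011, §10.1]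
[cite: Kato1994, Thm. (3.2)]
-/

noncomputable section

-- single-problem summit: the doubled namespace component is forced
set_option linter.dupNamespace false

open CategoryTheory AlgebraicGeometry TopologicalSpace IsLocalRing
open Literature.AlgebraicGeometry.Resolution

namespace Summit.ResolutionOfSingularities.ResolutionOfSingularities.Theorems.FRationalResolution.ClassOneFourthOneThree

open ClassOneThirdOneTwo VeroneseTwoChart ConeCertificateGenerators

/-- The exponent of `p ∈ ℕⁿ` in `ℤⁿ`. -/
local notation3 (prettyPrint := false) "toZ[" n "]" =>
  (Finsupp.mapRange.addMonoidHom (Nat.castAddMonoidHom ℤ) : (Fin n →₀ ℕ) →+ (Fin n →₀ ℤ))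

/-- The degree-2 exponents of `ℕ²`. -/
local notation3 (prettyPrint := false) "GQ2" => {d : Fin 2 →₀ ℕ | Finsupp.degree d = (2 : ℕ)}

/-- The Veronese monoid `⟨GQ2⟩`. -/
local notation3 (prettyPrint := false) "Q2" => AddSubmonoid.closure {d : Fin 2 →₀ ℕ | Finsupp.degree d = (2 : ℕ)}

/-! ## §1 A free vertex chart from a matrix (any `P ⊆ ℕ²`) -/

/-- **A free vertex chart of a surface class from a `2 × 2` integer matrix.** `P = ⟨G⟩ ⊆ ℕ²`, `v ∈ P`, a matrix `(a b; c d)` of non-zero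
determinant, and the three generator checks ((hPQ) on `G`, (hE) on `G`, (hQ) on `e₀, e₁`) for its map `ι : ℕ² → ℤ²`: then the per-vertex
slot of `…hasResolution_of_isolated_fixedPoints_of_mixedConeCertificate` holds with the FIRST disjunct (`κ[ℕ²]` regular).
[folklore; cite: CoxLittleSchenck2011, §1.2] -/
theorem freeChart_of_matrix (P : AddSubmonoid (Fin 2 →₀ ℕ)) (G : Set (Fin 2 →₀ ℕ)) (hGP : AddSubmonoid.closure G = P) (v : ↥P)
    (a' b' c' d' : ℤ) (hdet : a' * d' - b' * c' ≠ 0)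
    (hgen : ∀ ι : ↥(⊤ : AddSubmonoid (Fin 2 →₀ ℕ)) →+ (Fin 2 →₀ ℤ), (∀ u, ι u =
        Finsupp.single 0 (a' * ((u : Fin 2 →₀ ℕ) 0 : ℤ) + b' * ((u : Fin 2 →₀ ℕ) 1 : ℤ)) +
        Finsupp.single 1 (c' * ((u : Fin 2 →₀ ℕ) 0 : ℤ) + d' * ((u : Fin 2 →₀ ℕ) 1 : ℤ))) →
      (∀ g ∈ G, ∃ u : ↥(⊤ : AddSubmonoid (Fin 2 →₀ ℕ)), ι u = toZ[2] g) ∧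
      (∀ g ∈ G, ∃ u : ↥(⊤ : AddSubmonoid (Fin 2 →₀ ℕ)), ι u = toZ[2] g - toZ[2] (v : Fin 2 →₀ ℕ)) ∧
      (∀ u : ↥(⊤ : AddSubmonoid (Fin 2 →₀ ℕ)), (u : Fin 2 →₀ ℕ) ∈ Set.range (fun i : Fin 2 => (Finsupp.single i 1 : Fin 2 →₀ ℕ)) →
        ∃ (p : ↥P) (r : ℕ) (e : Fin r → ↥P), (∀ i, e i ≠ 0) ∧
          ι u = toZ[2] (p : Fin 2 →₀ ℕ) + ∑ i, (toZ[2] ((e i : ↥P) : Fin 2 →₀ ℕ) - toZ[2] (v : Fin 2 →₀ ℕ)))) :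
    ∃ (n' : ℕ) (Q : AddSubmonoid (Fin n' →₀ ℕ)) (ι : ↥Q →+ (Fin 2 →₀ ℤ)) (_ : Function.Injective ι)
      (_ : ∀ e : ↥P, e ≠ 0 → ∃ u : ↥Q, ι u = toZ[2] (e : Fin 2 →₀ ℕ) - toZ[2] (v : Fin 2 →₀ ℕ))
      (_ : ∀ p : ↥P, ∃ u : ↥Q, ι u = toZ[2] (p : Fin 2 →₀ ℕ))
      (_ : ∀ u : ↥Q, ∃ (p : ↥P) (r : ℕ) (e : Fin r → ↥P), (∀ i, e i ≠ 0) ∧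
        ι u = toZ[2] (p : Fin 2 →₀ ℕ) + ∑ i, (toZ[2] ((e i : ↥P) : Fin 2 →₀ ℕ) - toZ[2] (v : Fin 2 →₀ ℕ))),
      (∀ (κ : Type) [Field κ], IsRegularRing (AddMonoidAlgebra κ ↥Q)) ∨
      ∃ (GQ : Set (Fin n' →₀ ℕ)) (_ : GQ.Finite) (_ : (0 : Fin n' →₀ ℕ) ∉ GQ) (_ : AddSubmonoid.closure GQ = Q),
        (∀ (κ : Type) [Field κ], ∀ u : ↥Q, (u : Fin n' →₀ ℕ) ∈ GQ →
          IsRegularRing (Localization.Away (AddMonoidAlgebra.single u (1 : κ)))) ∧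
        (∀ (K : Type) [Field K], Scheme.IsRegular (affineBlowup (Ideal.span {w : ↥(Algebra.adjoin K
          ((fun d : Fin n' →₀ ℕ => MvPolynomial.monomial d (1 : K)) '' GQ)) |
          ∃ d ∈ GQ, (w : MvPolynomial (Fin n') K) = MvPolynomial.monomial d 1}))) := by
  obtain ⟨ι, hι⟩ := exists_coneHom a' b' c' d'
  obtain ⟨hG1, hG2, hG3⟩ := hgen ι hι
  have hPQ := forall_exists_eq_of_generators P ⊤ ι (toZ[2]) G hGP hG1
  exact ⟨2, ⊤, ι, coneHom_injective hdet ι hι, forall_exists_eq_sub_of_generators P ⊤ ι (toZ[2]) G hGP _ hG2 hPQ, hPQ,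
    forall_exists_decomp_of_generators P ⊤ ι (toZ[2]) _ _ (closure_range_single_one_eq_top 2) hG3,
    Or.inl fun κ _ => MonoidAlgebraLaurent.isRegularRing_monoidAlgebra_top κ 2⟩

/-! ## §2 The `A₁` chart of `1/4(1,3)` at the vertex `(1,1)` -/

/-- **The cone data of the vertex chart of `P = {4 ∣ m₀ + 3m₁}` at `(1,1)`**: `Q = ⟨{d : |d| = 2}⟩ ⊆ ℕ²` (the `A₁` cone, Veronese
presentation), `ι = L / 2` with `L = (3 −1; −1 3)`, and the second disjunct from `veroneseTwo_chartSlots`.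
[folklore; cite: CoxLittleSchenck2011, §10.1] -/
theorem middleChart_oneFourth (P : AddSubmonoid (Fin 2 →₀ ℕ)) (hcls : ∀ m : Fin 2 →₀ ℕ, m ∈ P ↔ 4 ∣ m 0 + 3 * m 1)
    (hGP : AddSubmonoid.closure ({Finsupp.single 0 4, Finsupp.single 0 1 + Finsupp.single 1 1, Finsupp.single 1 4} :
      Set (Fin 2 →₀ ℕ)) = P)
    (v : ↥P) (hv : (v : Fin 2 →₀ ℕ) = Finsupp.single 0 1 + Finsupp.single 1 1) :
    ∃ (n' : ℕ) (Q : AddSubmonoid (Fin n' →₀ ℕ)) (ι : ↥Q →+ (Fin 2 →₀ ℤ)) (_ : Function.Injective ι)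
      (_ : ∀ e : ↥P, e ≠ 0 → ∃ u : ↥Q, ι u = toZ[2] (e : Fin 2 →₀ ℕ) - toZ[2] (v : Fin 2 →₀ ℕ))
      (_ : ∀ p : ↥P, ∃ u : ↥Q, ι u = toZ[2] (p : Fin 2 →₀ ℕ))
      (_ : ∀ u : ↥Q, ∃ (p : ↥P) (r : ℕ) (e : Fin r → ↥P), (∀ i, e i ≠ 0) ∧
        ι u = toZ[2] (p : Fin 2 →₀ ℕ) + ∑ i, (toZ[2] ((e i : ↥P) : Fin 2 →₀ ℕ) - toZ[2] (v : Fin 2 →₀ ℕ))),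
      (∀ (κ : Type) [Field κ], IsRegularRing (AddMonoidAlgebra κ ↥Q)) ∨
      ∃ (GQ : Set (Fin n' →₀ ℕ)) (_ : GQ.Finite) (_ : (0 : Fin n' →₀ ℕ) ∉ GQ) (_ : AddSubmonoid.closure GQ = Q),
        (∀ (κ : Type) [Field κ], ∀ u : ↥Q, (u : Fin n' →₀ ℕ) ∈ GQ →
          IsRegularRing (Localization.Away (AddMonoidAlgebra.single u (1 : κ)))) ∧
        (∀ (K : Type) [Field K], Scheme.IsRegular (affineBlowup (Ideal.span {w : ↥(Algebra.adjoin K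
          ((fun d : Fin n' →₀ ℕ => MvPolynomial.monomial d (1 : K)) '' GQ)) |
          ∃ d ∈ GQ, (w : MvPolynomial (Fin n') K) = MvPolynomial.monomial d 1}))) := by
  -- the generators of `P` as elements
  have hg0P : (Finsupp.single 0 4 : Fin 2 →₀ ℕ) ∈ P := (hcls _).2 (by simp)
  have hg2P : (Finsupp.single 1 4 : Fin 2 →₀ ℕ) ∈ P := (hcls _).2 (by simp)
  have hv0 : v ≠ 0 := fun h => by
    have := DFunLike.congr_fun (congrArg Subtype.val h) 0
    rw [hv] at this
    simp at this
  have hne0 : (⟨Finsupp.single 0 4, hg0P⟩ : ↥P) ≠ 0 := fun h => by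
    have := DFunLike.congr_fun (congrArg Subtype.val h) 0; simp at this
  have hne2 : (⟨Finsupp.single 1 4, hg2P⟩ : ↥P) ≠ 0 := fun h => by
    have := DFunLike.congr_fun (congrArg Subtype.val h) 1; simp at this
  -- membership in `Q2` = even degree
  have memQ : ∀ m : Fin 2 →₀ ℕ, m ∈ Q2 ↔ 2 ∣ m 0 + m 1 := fun m => by
    rw [MonomialAlgebraCompletion.mem_closure_degree_eq_iff, Finsupp.degree_eq_sum, Fin.sum_univ_two]
  have mkQ : ∀ s t : ℕ, 2 ∣ s + t → ∃ q : ↥Q2, ((q : Fin 2 →₀ ℕ) 0 = s ∧ (q : Fin 2 →₀ ℕ) 1 = t) := fun s t h =>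
    ⟨⟨Finsupp.single 0 s + Finsupp.single 1 t, (memQ _).2 (by simpa using h)⟩, by simp, by simp⟩
  -- the integer matrix `L = (3 −1; −1 3)` and its half `ι`
  obtain ⟨L, hLM⟩ := exists_matrixHom (n := 2) (n' := 2) ![![3, -1], ![-1, 3]]
  have hL0 : ∀ u : Fin 2 →₀ ℕ, L u 0 = 3 * (u 0 : ℤ) + (-1) * (u 1 : ℤ) := fun u => by
    rw [hLM, Fin.sum_univ_two]; simp; ring
  have hL1 : ∀ u : Fin 2 →₀ ℕ, L u 1 = (-1) * (u 0 : ℤ) + 3 * (u 1 : ℤ) := fun u => by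
    rw [hLM, Fin.sum_univ_two]; simp; ring
  have hLinj : Function.Injective L := matrixHom_injective_two L 3 (-1) (-1) 3 hL0 hL1 (by norm_num)
  have hdvd : ∀ u : ↥Q2, ∀ i, (2 : ℤ) ∣ L (u : Fin 2 →₀ ℕ) i := by
    refine forall_dvd_of_generators Q2 L 2 GQ2 rfl fun g hg i => ?_
    rcases degree_two_cases g hg with ⟨g0, g1⟩ | ⟨g0, g1⟩ | ⟨g0, g1⟩ <;> fin_cases i <;>
      simp only [Fin.zero_eta, Fin.mk_one, Fin.isValue, hL0, hL1, g0, g1] <;> norm_num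
  obtain ⟨ι, hι⟩ := exists_hom_of_dvd Q2 L 2 hdvd
  have hιinj : Function.Injective ι :=
    hom_injective Q2 L 2 ι hι fun u w h => Subtype.ext (hLinj h)
  have heq : ∀ (u : ↥Q2) (z : Fin 2 →₀ ℤ), L (u : Fin 2 →₀ ℕ) 0 = 2 * z 0 → L (u : Fin 2 →₀ ℕ) 1 = 2 * z 1 → ι u = z :=
    fun u z h0 h1 => (hom_apply_eq_iff Q2 L 2 two_ne_zero ι hι u z).2 fun i => by fin_cases i; exacts [h0, h1]
  -- the exponents of the generators of `P` and of `v`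
  have hvZ : toZ[2] (v : Fin 2 →₀ ℕ) = Finsupp.single 0 1 + Finsupp.single 1 1 := by rw [hv, map_add]; simp
  -- (hPQ) on the generators of `P`
  have hG1 : ∀ g ∈ ({Finsupp.single 0 4, Finsupp.single 0 1 + Finsupp.single 1 1, Finsupp.single 1 4} : Set (Fin 2 →₀ ℕ)),
      ∃ u : ↥Q2, ι u = toZ[2] g := by
    rintro g (rfl | rfl | rfl)
    · obtain ⟨q, q0, q1⟩ := mkQ 3 1 (by norm_num)
      exact ⟨q, heq q _ (by rw [hL0, q0, q1]; simp) (by rw [hL1, q0, q1]; simp)⟩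
    · obtain ⟨q, q0, q1⟩ := mkQ 1 1 (by norm_num)
      exact ⟨q, heq q _ (by rw [hL0, q0, q1]; simp) (by rw [hL1, q0, q1]; simp)⟩
    · obtain ⟨q, q0, q1⟩ := mkQ 1 3 (by norm_num)
      exact ⟨q, heq q _ (by rw [hL0, q0, q1]; simp) (by rw [hL1, q0, q1]; simp)⟩
  have hPQ := forall_exists_eq_of_generators P Q2 ι (toZ[2]) _ hGP hG1
  -- (hE) on the generators of `P`
  have hG2 : ∀ g ∈ ({Finsupp.single 0 4, Finsupp.single 0 1 + Finsupp.single 1 1, Finsupp.single 1 4} : Set (Fin 2 →₀ ℕ)),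
      ∃ u : ↥Q2, ι u = toZ[2] g - toZ[2] (v : Fin 2 →₀ ℕ) := by
    rintro g (rfl | rfl | rfl)
    · obtain ⟨q, q0, q1⟩ := mkQ 2 0 (by norm_num)
      exact ⟨q, heq q _ (by rw [hL0, q0, q1, hvZ]; simp) (by rw [hL1, q0, q1, hvZ]; simp)⟩
    · exact ⟨0, by rw [map_zero, hv, sub_self]⟩
    · obtain ⟨q, q0, q1⟩ := mkQ 0 2 (by norm_num)
      exact ⟨q, heq q _ (by rw [hL0, q0, q1, hvZ]; simp) (by rw [hL1, q0, q1, hvZ]; simp)⟩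
  have hE := forall_exists_eq_sub_of_generators P Q2 ι (toZ[2]) _ hGP _ hG2 hPQ
  -- (hQ) on the degree-2 generators of `Q2`
  have hG3 : ∀ u : ↥Q2, (u : Fin 2 →₀ ℕ) ∈ GQ2 → ∃ (p : ↥P) (r : ℕ) (e : Fin r → ↥P), (∀ i, e i ≠ 0) ∧
      ι u = toZ[2] (p : Fin 2 →₀ ℕ) + ∑ i, (toZ[2] ((e i : ↥P) : Fin 2 →₀ ℕ) - toZ[2] (v : Fin 2 →₀ ℕ)) := by
    intro u hu
    rcases degree_two_cases _ hu with ⟨u0, u1⟩ | ⟨u0, u1⟩ | ⟨u0, u1⟩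
    · refine ⟨0, 1, ![⟨Finsupp.single 0 4, hg0P⟩], fun i => by fin_cases i; exact hne0, ?_⟩
      refine heq u _ ?_ ?_
      · rw [hL0, u0, u1, Fin.sum_univ_one, hvZ]; simp
      · rw [hL1, u0, u1, Fin.sum_univ_one, hvZ]; simp
    · refine ⟨v, 0, Fin.elim0, fun i => i.elim0, ?_⟩
      refine heq u _ ?_ ?_
      · rw [hL0, u0, u1, Finset.univ_eq_empty, Finset.sum_empty, add_zero, hvZ]; simp
      · rw [hL1, u0, u1, Finset.univ_eq_empty, Finset.sum_empty, add_zero, hvZ]; simp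
    · refine ⟨0, 1, ![⟨Finsupp.single 1 4, hg2P⟩], fun i => by fin_cases i; exact hne2, ?_⟩
      refine heq u _ ?_ ?_
      · rw [hL0, u0, u1, Fin.sum_univ_one, hvZ]; simp
      · rw [hL1, u0, u1, Fin.sum_univ_one, hvZ]; simp
  have hQ := forall_exists_decomp_of_generators P Q2 ι (toZ[2]) (toZ[2] (v : Fin 2 →₀ ℕ)) GQ2 rfl hG3
  obtain ⟨hfin, h0, hface, hvert⟩ := veroneseTwo_chartSlots
  exact ⟨2, Q2, ι, hιinj, hE, hPQ, hQ, Or.inr ⟨GQ2, hfin, h0, rfl, hface, hvert⟩⟩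

/-! ## §3 The class `1/4(1,3)` -/

/-- ★★★★ **RESOLUTION OF VARIETIES WHOSE SINGULAR POINTS ARE ISOLATED FIXED POINTS OF TYPE `1/4(1,3)`.** As
`…ClassOneThirdOneTwo.hasResolution_of_isolated_fixedPoints_oneThird` with weight kernel `{m : 4 ∣ m₀ + 3 m₁}` (`A₃`; any
characteristic). The first blow-up has one singular point, an `A₁` (Veronese) vertex, resolved by the second.
[folklore; cite: CoxLittleSchenck2011, §10.1] [cite: Kato1994, Thm. (3.2)] -/
theorem hasResolution_of_isolated_fixedPoints_oneFourth (k : Type) [Field k] (X : Scheme.{0}) [IsIntegral X]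
    (f : X ⟶ Spec (.of k)) [LocallyOfFiniteType f] (hfin : (Scheme.regularLocus X)ᶜ.Finite)
    (hchart : ∀ t : X, t ∉ Scheme.regularLocus X →
      ∃ (k' : Type) (_ : Field k') (A : Type) (_ : DecidableEq A) (_ : AddCommGroup A) (_ : AddMonoid.IsTorsion A)
        (S : Type) (_ : CommRing S) (_ : Algebra k' S) (𝒮 : A → Submodule k' S) (_ : GradedAlgebra 𝒮)
        (_ : Algebra.FiniteType k' S) (φ : Spec (.of (𝒮 0)) ⟶ X) (_ : Etale φ)
        (𝔔 : Ideal S) (_ : 𝔔.IsPrime) (_ : ∀ a : A, a ≠ 0 → ∀ s ∈ 𝒮 a, s ∈ 𝔔)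
        (x : Fin 2 → S) (a : Fin 2 → A) (P : AddSubmonoid (Fin 2 →₀ ℕ))
        (_ : ∀ i, x i ∈ 𝔔 ∧ x i ∈ 𝒮 (a i))
        (_ : Ideal.span (algebraMap S (Localization.AtPrime 𝔔) '' Set.range x) = maximalIdeal (Localization.AtPrime 𝔔))
        (_ : ((2 : ℕ) : WithBot ℕ∞) = ringKrullDim (Localization.AtPrime 𝔔))
        (_ : ∀ m, m ∈ P ↔ Finsupp.weight a m = 0)
        (_ : ∀ m : Fin 2 →₀ ℕ, m ∈ P ↔ 4 ∣ m 0 + 3 * m 1),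
        φ ⟨𝔔.comap (algebraMap (𝒮 0) S), inferInstance⟩ = t) :
    Scheme.HasResolution X := by
  refine MonoidAlgebraLaurent.hasResolution_of_isolated_fixedPoints_of_mixedConeCertificate k X f hfin fun t ht => ?_
  have hc := hchart t ht
  obtain ⟨k', ik, A, iA₁, iA₂, hA, S, iS₁, iS₂, 𝒮, i𝒮, iS₃, φ, iφ, 𝔔, i𝔔, hfix, x, a, P, hxa, hspan, hn, hP, hcls, hφt⟩ := hc
  -- ### the Hilbert basis `G = {(4,0), (1,1), (0,4)}`
  have hg0P : (Finsupp.single 0 4 : Fin 2 →₀ ℕ) ∈ P := (hcls _).2 (by simp)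
  have hg1P : (Finsupp.single 0 1 + Finsupp.single 1 1 : Fin 2 →₀ ℕ) ∈ P := (hcls _).2 (by simp)
  have hg2P : (Finsupp.single 1 4 : Fin 2 →₀ ℕ) ∈ P := (hcls _).2 (by simp)
  let G : Set (Fin 2 →₀ ℕ) := {Finsupp.single 0 4, Finsupp.single 0 1 + Finsupp.single 1 1, Finsupp.single 1 4}
  have hGfin : G.Finite := ((Set.finite_singleton _).insert _).insert _
  have hGP' : G ⊆ P := by
    rintro g (rfl | rfl | rfl)
    exacts [hg0P, hg1P, hg2P]
  have hG0 : (0 : Fin 2 →₀ ℕ) ∉ G := by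
    rintro (h | h | h)
    · have := DFunLike.congr_fun h 0; simp at this
    · have := DFunLike.congr_fun h 0; simp at this
    · have := DFunLike.congr_fun h 1; simp at this
  have hGP : AddSubmonoid.closure G = P := by
    refine WeightKernelBasis.closure_eq_of_box P G hGP' ?_ 4 (by norm_num) ?_ ?_
    · intro m hm g hg hgm
      have hm' := (hcls m).1 hm
      have hg' := (hcls g).1 hg
      have h0 := Finsupp.le_def.1 hgm 0
      have h1 := Finsupp.le_def.1 hgm 1
      refine (hcls _).2 ?_
      simp only [Finsupp.tsub_apply]
      omega
    · intro i
      fin_cases i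
      · exact Or.inl rfl
      · exact Or.inr (Or.inr rfl)
    · intro m hm hm0 hlt
      have hm' := (hcls m).1 hm
      have h0 := hlt 0
      have h1 := hlt 1
      have hne : m 0 ≠ 0 ∨ m 1 ≠ 0 := by
        by_contra h
        push Not at h
        exact hm0 (by ext i; fin_cases i <;> simp [h.1, h.2])
      refine ⟨Finsupp.single 0 1 + Finsupp.single 1 1, Or.inr (Or.inl rfl), ?_, ?_⟩
      · intro h
        have := DFunLike.congr_fun h 0
        simp at this
      · refine Finsupp.le_def.2 fun i => ?_
        fin_cases i
        · simp; omega
        · simp; omega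
  -- ### the enumeration `gen` of `G` (all three are vertices)
  let gen : Fin 3 → ↥P := ![⟨Finsupp.single 0 4, hg0P⟩, ⟨Finsupp.single 0 1 + Finsupp.single 1 1, hg1P⟩, ⟨Finsupp.single 1 4, hg2P⟩]
  have hgen0 : ((gen 0 : ↥P) : Fin 2 →₀ ℕ) = Finsupp.single 0 4 := rfl
  have hgen1 : ((gen 1 : ↥P) : Fin 2 →₀ ℕ) = Finsupp.single 0 1 + Finsupp.single 1 1 := rfl
  have hgen2 : ((gen 2 : ↥P) : Fin 2 →₀ ℕ) = Finsupp.single 1 4 := rfl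
  have hgenG : ∀ i, ((gen i : ↥P) : Fin 2 →₀ ℕ) ∈ G := by
    intro i
    fin_cases i
    · exact Or.inl hgen0
    · exact Or.inr (Or.inl hgen1)
    · exact Or.inr (Or.inr hgen2)
  have hGgen : ∀ g ∈ G, ∃ i, ((gen i : ↥P) : Fin 2 →₀ ℕ) = g := by
    rintro g (rfl | rfl | rfl)
    exacts [⟨0, hgen0⟩, ⟨1, hgen1⟩, ⟨2, hgen2⟩]
  have hv0 : ∀ j, gen j ≠ 0 := by
    intro j h
    have h' : ((gen j : ↥P) : Fin 2 →₀ ℕ) = 0 := by rw [h]; rfl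
    exact hG0 (h' ▸ hgenG j)
  refine ⟨k', ik, A, iA₁, iA₂, hA, S, iS₁, iS₂, 𝒮, i𝒮, iS₃, φ, iφ, 𝔔, i𝔔, hfix, 2, x, a, P, hxa, hspan, hn, hP, G, hGfin, hG0, hGP,
    hφt, 3, gen, hgenG, hGgen, 3, gen, hv0, 1, le_rfl, id, fun _ => 0, fun _ => le_rfl, fun _ => Fin.elim0,
    fun _ l => l.elim0, fun i => by simp, fun j => ?_⟩
  have mem : ∀ w : Fin 2 →₀ ℕ, w ∈ (⊤ : AddSubmonoid (Fin 2 →₀ ℕ)) := fun w => AddSubmonoid.mem_top w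
  fin_cases j
  · -- vertex `(4,0)`: free chart cone generated by `(4,0), (−3,1)`
    refine freeChart_of_matrix P G hGP (gen 0) 4 (-3) 0 1 (by norm_num) fun ι hι => ⟨?_, ?_, ?_⟩
    · rintro g (rfl | rfl | rfl)
      · exact ⟨⟨Finsupp.single 0 1, mem _⟩, coneHom_eq ι hι _ _ (by simp) (by simp)⟩
      · exact ⟨⟨Finsupp.single 0 1 + Finsupp.single 1 1, mem _⟩, coneHom_eq ι hι _ _ (by simp) (by simp)⟩
      · exact ⟨⟨Finsupp.single 0 3 + Finsupp.single 1 4, mem _⟩, coneHom_eq ι hι _ _ (by simp) (by simp)⟩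
    · rintro g (rfl | rfl | rfl)
      · exact ⟨0, by rw [map_zero, hgen0, sub_self]⟩
      · exact ⟨⟨Finsupp.single 1 1, mem _⟩, coneHom_eq ι hι _ _ (by simp [hgen0]) (by simp [hgen0])⟩
      · exact ⟨⟨Finsupp.single 0 2 + Finsupp.single 1 4, mem _⟩, coneHom_eq ι hι _ _ (by simp [hgen0]) (by simp [hgen0])⟩
    · rintro u ⟨i, hi⟩
      fin_cases i
      · refine ⟨gen 0, 0, Fin.elim0, fun i => i.elim0, ?_⟩
        rw [Finset.univ_eq_empty, Finset.sum_empty, add_zero]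
        exact coneHom_eq ι hι _ _ (by simp [← hi, hgen0]) (by simp [← hi, hgen0])
      · refine ⟨0, 1, ![gen 1], fun i => by fin_cases i; exact hv0 1, ?_⟩
        rw [Fin.sum_univ_one]
        exact coneHom_eq ι hι _ _ (by simp [← hi, hgen0, hgen1]) (by simp [← hi, hgen0, hgen1])
  · -- vertex `(1,1)`: the `A₁` chart
    exact middleChart_oneFourth P hcls hGP (gen 1) hgen1
  · -- vertex `(0,4)`: free chart cone generated by `(1,−3), (0,4)`
    refine freeChart_of_matrix P G hGP (gen 2) 1 0 (-3) 4 (by norm_num) fun ι hι => ⟨?_, ?_, ?_⟩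
    · rintro g (rfl | rfl | rfl)
      · exact ⟨⟨Finsupp.single 0 4 + Finsupp.single 1 3, mem _⟩, coneHom_eq ι hι _ _ (by simp) (by simp)⟩
      · exact ⟨⟨Finsupp.single 0 1 + Finsupp.single 1 1, mem _⟩, coneHom_eq ι hι _ _ (by simp) (by simp)⟩
      · exact ⟨⟨Finsupp.single 1 1, mem _⟩, coneHom_eq ι hι _ _ (by simp) (by simp)⟩
    · rintro g (rfl | rfl | rfl)
      · exact ⟨⟨Finsupp.single 0 4 + Finsupp.single 1 2, mem _⟩, coneHom_eq ι hι _ _ (by simp [hgen2]) (by simp [hgen2])⟩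
      · exact ⟨⟨Finsupp.single 0 1, mem _⟩, coneHom_eq ι hι _ _ (by simp [hgen2]) (by simp [hgen2])⟩
      · exact ⟨0, by rw [map_zero, hgen2, sub_self]⟩
    · rintro u ⟨i, hi⟩
      fin_cases i
      · refine ⟨0, 1, ![gen 1], fun i => by fin_cases i; exact hv0 1, ?_⟩
        rw [Fin.sum_univ_one]
        exact coneHom_eq ι hι _ _ (by simp [← hi, hgen1, hgen2]) (by simp [← hi, hgen1, hgen2])
      · refine ⟨gen 2, 0, Fin.elim0, fun i => i.elim0, ?_⟩
        rw [Finset.univ_eq_empty, Finset.sum_empty, add_zero]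
        exact coneHom_eq ι hι _ _ (by simp [← hi, hgen2]) (by simp [← hi, hgen2])

end Summit.ResolutionOfSingularities.ResolutionOfSingularities.Theorems.FRationalResolution.ClassOneFourthOneThree

end
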